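import Literature.AlgebraicGeometry.ModuliOfAbelianVarieties.SiegelFamilyHumbertLemma
import Literature.AlgebraicGeometry.ModuliOfAbelianVarieties.SiegelFamilyHumbertSquareInvariantDegrees
import Literature.AlgebraicGeometry.ModuliOfAbelianVarieties.SiegelFamilyHumbertModularSplit
import HarnessLib

/-!
# The Humbert surface of invariant `Δ` is ONE `Sp₄(ℤ)`-orbit of Runge's model `ℍ × ℍ`:
# `N_Δ = Sp₄(ℤ) · π_Δ(ℍ × ℍ)`, `H_Δ(𝔥₂) = ⋃_{m²Δ′ = Δ} N_{Δ′}`, and `H_1(𝔥₂) = Sp₄(ℤ) · {diagonal period matrices}`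

Layer `Literature/AlgebraicGeometry/ModuliOfAbelianVarieties`, namespace
`Literature.AlgebraicGeometry.ModuliOfAbelianVarieties.SiegelModuli`; lane `lit-hodgefound` (Track 2 foundations library,
Layer A4), seat `lit-hodgefound-skel-4`, row **A4-65**, FILE 2 — the locus-level consequences of FILE 1
(`SiegelFamilyHumbertLemma`: `HumbertEquiv`, `IsPrimitiveRel`, Humbert's lemma `IsPrimitiveRel.humbertEquiv_humbertNormalForm`
/ `IsPrimitiveRel.humbertEquiv_iff`, the B–W forms `humbertEquiv_bw_zero/_one`), read on `𝔥₂` through row A4-59″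
(`mem_humbertLocus_humbertVectorConj_iff : Z ∈ H_{q^M} ⟺ (ᵗM)⁻¹ · Z ∈ H_q`, `humbertLocusOfInvariant Δ = H_Δ(𝔥₂)`,
`smul_mem_humbertLocusOfInvariant_iff`), row A4-64 (`range_modularEmbedding : π_{k,l}(ℍ × ℍ) = H_{(k,l,−1,0,0)}`, FILE 6
`modularEmbedding_zero_one_eq_smul_diagPoint`, `range_diagPoint`), row A4-62 (`exists_eq_smul_primitive` — the content of
a relation; `exists_primitive_relation_sq_iff_exists_ellipticCurve_degree_eq` — Kani) and row A4-16 (`gDHom : Sp₄(ℤ) → Sp₄(ℝ)`,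
`gDHom_inv`, `symplecticLatticeGroup`) — all BY NAME.

## Sources (verbatim)

* K. Hashimoto, N. Murabayashi, *Shimura curves as intersections of Humbert surfaces and defining equations of QM-curves
  of genus two*, Tohoku Math. J. **47** (1995) (read in the RIMS Kôkyûroku 843 (1993) version held in the corpus, p. 191):
  "Definition 3.6 (Humbert [7]) … `τ` has a singular relation with invariant `Δ` if there exists an element
  `(a, b, c, d, e) (≠ 0) ∈ ℤ⁵` such that: 1. `a, b, c, d, e` are relatively prime 2. `aτ₁ + bτ₂ + cτ₃ + d(τ₂² − τ₁τ₃) + e = 0`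
  3. `Δ = b² − 4ac − 4de`. … Define `N_Δ = {τ ∈ 𝔥₂ | τ` has a singular relation with invariant `Δ}` and `H_Δ =` image of
  `N_Δ` under the canonical map `𝔥₂ → Sp(4, ℤ)\𝔥₂` … is called the Humbert surface of invariant `Δ`. The following
  result, which is stated explicitly in [2], p.212, is essentially due to Humbert: Proposition 3.7 Each point of `H_Δ`
  can be represented by `τ ∈ 𝔥₂` satisfying an equation `aτ₁ + bτ₂ + τ₃ = 0` with `b² − 4a = Δ`, `b = 0` or `1`."
* B. Runge, Tohoku Math. J. **51** (1999), §4 p. 290: "Humbert proved that up to equivalence any relation may be written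
  as `kτ₁ + lτ₂ = τ₃` (see [HM, 2.7]). The theorem allows us to construct the following standard model for Humbert
  surfaces …", p. 291: "By the last theorem any period `τ` … with `O ⊂ End(A_τ)` lies in a manifold `H(F)` as constructed
  above. By taking the quotient `Γ(F)\H(F)`, we get the standard model for Humbert surfaces."
* Ch. Birkenhake, H. Wilhelm, Trans. AMS **355** (2003), p. 1828, Prop. 4.5: "There is an `M ∈ Sp₄(ℤ)` such that
  `M(Z) = (z₁′ z₂′; z₂′ z₃′)` satisfies `−¼Δz₁′ + z₃′ = 0` if `Δ ≡ 0 mod 4`, `¼(1 − Δ)z₁′ + z₂′ + z₃′ = 0` if `Δ ≡ 1 mod 4`";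
  p. 1829: "This shows, in particular, that equation (8) induces an equation on the moduli space `𝒜₂` which is uniquely
  determined by the discriminant `Δ`"; p. 1830: "Obviously we have `H_Δ ⊆ H_{m²Δ}` for any positive integer `m`" and
  Prop. 4.8 (`H_{δ²}` = surfaces containing an elliptic curve `E` with `(E · H) = δ`).
* J.-W. Guo, Y. Yang, arXiv:1903.07225, §2: "Humbert proved that under the natural projection `ℌ₂ → 𝒜₂`, all primitive
  singular relations with the same discriminant `n` … defines the same zero locus in `𝒜₂`, which is called the Humbert
  surface `H_n` of discriminant `n`."

## Contents (definitions with bodies and PROVED theorems; NO named fact, net debt 0)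

* §1 **`humbertLocusPrim Δ = N_Δ`** `:= ⋃ {H_q : q primitive, Δ(q) = Δ}` (Hashimoto–Murabayashi's `N_Δ`; row A4-59″'s
  `humbertLocusOfInvariant` takes ALL `q ≠ 0`): `mem_humbertLocusPrim_iff`, `humbertLocus_subset_humbertLocusPrim`,
  `humbertLocusPrim_subset_humbertLocusOfInvariant`, `range_modularEmbedding_subset_humbertLocusPrim` (Runge's model lies in
  `N_Δ`), **`humbertLocusOfInvariant_eq_iUnion_humbertLocusPrim`** (`H_Δ(𝔥₂) = ⋃_{m > 0, m² ∣ Δ} N_{Δ/m²}` — the content of a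
  relation), `humbertLocusOfInvariant_eq_humbertLocusPrim_of_squarefree`, `humbertLocusPrim_nonempty_iff`
  (`N_Δ ≠ ∅ ⟺ Δ > 0 ∧ Δ ≡ 0, 1 mod 4`).
* §2 `smul_mem_humbertLocus_humbertVectorConj` (`Z ∈ H_q ⟹ ᵗM · Z ∈ H_{q^M}`) and **`smul_mem_humbertLocusPrim_iff`**: `N_Δ` is
  `Sp₄(ℤ)`-stable, so `H_Δ = N_Δ/Sp₄(ℤ)` is well defined.
* §3 Humbert's lemma on `𝔥₂`: **`IsPrimitiveRel.exists_humbertLocus_eq_image_humbertNormalForm`** (`H_q = ᵗM · H_{(k,l,−1,0,0)}`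
  for EVERY primitive `q` and every `l² + 4k = Δ(q)`), **`…exists_humbertLocus_eq_image_range_modularEmbedding`** (`H_q = ᵗM ·
  π_{k,l}(ℍ × ℍ)`: every Humbert surface of a primitive relation is a translate of Runge's standard model),
  `…exists_eq_smul_modularEmbedding`, `…exists_smul_mem_humbertLocus_humbertNormalForm`, B–W Prop. 4.5 AS PRINTED (on the
  ENTRIES of `M(Z)`) for every primitive relation: **`IsPrimitiveRel.exists_smul_bw_zero`** (`−(Δ/4) z₁′ + z₃′ = 0`),
  **`IsPrimitiveRel.exists_smul_bw_one`** (`(1−Δ)/4 · z₁′ + z₂′ + z₃′ = 0`); `spUnit M hM : Sp₄(ℤ)` (the `GL₄(ℤ)`-unit with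
  inverse FILE 1's `spInv M`), `gDHom_spUnit`; **`humbertLocusPrim_eq_iUnion_image_range_modularEmbedding`**:
  `N_{l²+4k} = ⋃_{γ ∈ Sp₄(ℤ)} γ · π_{k,l}(ℍ × ℍ)` — `H_Δ ⊂ 𝒜₂` is the image of ONE copy of `ℍ × ℍ`;
  `mem_humbertLocusPrim_iff_exists_smul_modularEmbedding` (pointwise), `mem_humbertLocusOfInvariant_iff_exists_smul_modularEmbedding`
  (`Z ∈ H_Δ(𝔥₂) ⟺ Z = γ · π_{k,l}(τ)` with `m²(l² + 4k) = Δ`).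
* §4 Invariant `1` and squares: `humbertLocusOfInvariant_one_eq_humbertLocusPrim`,
  **`humbertLocusOfInvariant_one_eq_iUnion_image_diagonal`** (`H_1(𝔥₂) = ⋃_{γ ∈ Sp₄(ℤ)} γ · {Z : z₂ = 0}`),
  **`mem_humbertLocusOfInvariant_one_iff_exists_smul_diagonal`** (`Z ∈ H_1(𝔥₂) ⟺` some `γ ∈ Sp₄(ℤ)` DIAGONALISES `Z`),
  `mem_humbertLocusPrim_sq_iff_exists_ellipticCurve` (`N_{δ²}` = Kani's locus "`X_Z` contains an elliptic curve of degree
  `δ`", row A4-62), `quadDisc_zero(_pos)`, **`exists_ellipticCurve_iff_exists_smul_modularEmbedding`** (… `⟺ Z = γ · π_{(0,δ)}(τ)`: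
  the surfaces with an elliptic curve of degree `δ` are ONE `Sp₄(ℤ)`-orbit of the split Runge model of `ℚ × ℚ`).
* §5 The Néron–Severi side (Kani's `H_N = {⟨A,θ⟩ : q_{(A,θ)} → N}`, row A4-62 BY NAME):
  **`mem_humbertLocusPrim_iff_exists_isNSForm_primitive`** (`Z ∈ N_Δ ⟺` some `D ∈ NS(X_Z)` PRIMITIVE modulo `θ_Z` has
  refined Humbert value `(D·θ_Z)² − 2(D·D) = Δ`) and `exists_isNSForm_primitive_iff_exists_smul_modularEmbedding`
  (such `Z` are exactly the `γ · π_{k,l}(τ)`).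

## Scope / what is NOT formalised here

* `𝒜₂ = Sp₄(ℤ)\𝔥₂` and `H_Δ ⊂ 𝒜₂` as spaces are not formed: "one orbit" is expressed inside `𝔥₂` as the union over
  `γ ∈ Sp₄(ℤ)` (acting through row A4-16's `gDHom`) of the translates of ONE connected surface `π_{k,l}(ℍ × ℍ) ≅ ℍ × ℍ`
  (row A4-64 `modularEmbeddingHomeomorph`); irreducibility of `H_Δ` as an analytic set is this statement, no dimension
  theory.
* For `H_1`: "`X_Z ≅ E₁ × E₂` as principally polarised abelian surfaces" is rendered as "`Z` is `Sp₄(ℤ)`-equivalent to a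
  diagonal period matrix"; the isomorphism of abelian surfaces behind the `Sp₄(ℤ)`-action is rows A4-16 / A4-56′
  (`SiegelModuliRelation`), not restated; the degree-`δ` isogeny picture for `Δ = δ² > 1` (gen 14's note (2)) is left open.
* Runge's Thm. 2 (Rosati-invariant MATRICES up to `Γ₂`-conjugacy: trace, content and invariant) is FILE 3 of the row
  (`SiegelFamilyHumbertRungeConjugacy`).

## References

* [HashimotoMurabayashi1995] K. Hashimoto, N. Murabayashi, Tohoku Math. J. 47 (1995) 271–296; Def. 3.6 / Prop. 3.7 of the
  RIMS Kôkyûroku 843 (1993) version (p. 191) = Prop. 2.7 of the journal version.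
* [Runge1999EndomorphismRingsAbelianSurfaces] B. Runge, Tohoku Math. J. 51 (1999) 283–303, §4 Thm. 2 (p. 288), pp. 290–291.
* [BirkenhakeWilhelm2003] Ch. Birkenhake, H. Wilhelm, Trans. AMS 355 (2003) 1819–1841, §4 Prop. 4.5 (p. 1828), p. 1829,
  Prop. 4.7–4.8 (p. 1830).
* [GuoYang2019] J.-W. Guo, Y. Yang, arXiv:1903.07225, §2.
* [Kani1994EllipticCurvesAbelianSurfaces] E. Kani, *Elliptic curves on abelian surfaces*, Manuscripta Math. 84 (1994) — through
  row A4-62.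
* [vanderGeer1988HilbertModularSurfaces] G. van der Geer, *Hilbert Modular Surfaces* (1988), Ch. IX §2 (p. 212) — cited through
  Hashimoto–Murabayashi (not held).
* [Lange2023AbelianVarietiesComplex] H. Lange, *Abelian Varieties over the Complex Numbers* (2023), §3.1.4 (3.8), §8.2 (8.5).
-/
noncomputable section

open Matrix Complex Module Function Set
open scoped UpperHalfPlane

namespace Literature.AlgebraicGeometry.ModuliOfAbelianVarieties

namespace SiegelModuli

open Literature.NumberTheory.Automorphic (siegelUpperHalfSpace)
open Literature.NumberTheory.ModularForms.SiegelUpperHalfSpace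
open Literature.Geometry.Kaehler Literature.Geometry.Kaehler.ComplexTorus
open Literature.Analysis.Complex Literature.LinearAlgebra.Alternating
open Sum

/-! ## §1 Hashimoto–Murabayashi's `N_Δ`: the points of `𝔥₂` with a PRIMITIVE singular relation of invariant `Δ` -/

section NDelta

/-- **`N_Δ = {Z ∈ 𝔥₂ : Z has a PRIMITIVE singular relation of invariant Δ}`** — "`N_Δ = {τ ∈ 𝔥₂ | τ` has a singular
relation with invariant `Δ}`" with "`a, b, c, d, e` are relatively prime" in the definition of a singular relation
(Hashimoto–Murabayashi Def. 3.6), "`H_Δ = image of N_Δ` under the canonical map `𝔥₂ → Sp(4, ℤ)\𝔥₂` … is called the Humbert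
surface of invariant `Δ`"; the union of the Humbert loci `H_q` (row A4-59) over the primitive `q ∈ ℤ⁵` with `Δ(q) = Δ`.
Compare row A4-59″'s `humbertLocusOfInvariant Δ = H_Δ(𝔥₂)` (ALL `q ≠ 0`; `= ⋃_{f² ∣ Δ} N_{Δ/f²}`,
`humbertLocusOfInvariant_eq_iUnion_humbertLocusPrim`). [cite: HashimotoMurabayashi1995, Def. 3.6 (RIMS Kôkyûroku 843 version, p. 191)] [cite: GuoYang2019, §2] -/
def humbertLocusPrim (Δ : ℤ) : Set (siegelUpperHalfSpace 2) :=
  ⋃ (q : Fin 5 → ℤ) (_ : IsPrimitiveRel q ∧ humbertInvariant q = Δ), humbertLocus (fun i ↦ (q i : ℂ))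

/-- Membership in `N_Δ`. [cite: HashimotoMurabayashi1995, Def. 3.6] -/
theorem mem_humbertLocusPrim_iff {Δ : ℤ} {Z : siegelUpperHalfSpace 2} :
    Z ∈ humbertLocusPrim Δ ↔
      ∃ q : Fin 5 → ℤ, IsPrimitiveRel q ∧ humbertInvariant q = Δ ∧ Z ∈ humbertLocus (fun i ↦ (q i : ℂ)) := by
  simp only [humbertLocusPrim, Set.mem_iUnion, exists_prop, and_assoc]

/-- `H_q ⊆ N_{Δ(q)}` for primitive `q`. [cite: HashimotoMurabayashi1995, Def. 3.6] -/
theorem humbertLocus_subset_humbertLocusPrim {q : Fin 5 → ℤ} (hq : IsPrimitiveRel q) :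
    humbertLocus (fun i ↦ (q i : ℂ)) ⊆ humbertLocusPrim (humbertInvariant q) :=
  fun _ hZ ↦ mem_humbertLocusPrim_iff.2 ⟨q, hq, rfl, hZ⟩

/-- **`N_Δ ⊆ H_Δ(𝔥₂)`** (row A4-59″'s locus over all non-zero relations). [cite: BirkenhakeWilhelm2003, §1 (∗) (p. 1819)] -/
theorem humbertLocusPrim_subset_humbertLocusOfInvariant (Δ : ℤ) :
    humbertLocusPrim Δ ⊆ humbertLocusOfInvariant Δ := by
  intro Z hZ
  obtain ⟨q, hq, hqΔ, hZq⟩ := mem_humbertLocusPrim_iff.1 hZ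
  exact mem_humbertLocusOfInvariant_iff.2 ⟨q, hq.ne_zero, hqΔ, hZq⟩

/-- **Runge's model lies in `N_Δ`: `π_{k,l}(ℍ × ℍ) ⊆ N_{l² + 4k}`** (row A4-64: `range π_{k,l} = H_{(k,l,−1,0,0)}`, a primitive
relation). [cite: Runge1999EndomorphismRingsAbelianSurfaces, §4 pp. 290–291] -/
theorem range_modularEmbedding_subset_humbertLocusPrim {k l : ℤ} (hΔ : 0 < quadDisc k l) :
    Set.range (modularEmbedding k l hΔ) ⊆ humbertLocusPrim (quadDisc k l) := by
  rw [range_modularEmbedding hΔ, ← humbertInvariant_humbertNormalForm k l]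
  exact humbertLocus_subset_humbertLocusPrim (isPrimitiveRel_humbertNormalForm k l)

/-- Casting a multiple: `(m q)_ℂ = m · q_ℂ`. [folklore] -/
private theorem intCast_smul_eq (m : ℤ) (q : Fin 5 → ℤ) :
    (fun i ↦ ((m • q) i : ℂ)) = (m : ℂ) • fun i ↦ (q i : ℂ) := by
  funext i
  rw [Pi.smul_apply, Pi.smul_apply, smul_eq_mul, smul_eq_mul, Int.cast_mul]

/-- **`H_Δ(𝔥₂) = ⋃_{m > 0, m² ∣ Δ} N_{Δ/m²}`**: a non-zero relation is `m ·` a primitive one (content `m`, FILE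
`SiegelFamilyHumbertSquareInvariantDegrees.exists_eq_smul_primitive`) with the same locus and invariant `m²Δ′` ("Obviously
we have `H_Δ ⊆ H_{m²Δ}`", B–W p. 1830; for `Δ = δ²` this is B–W Prop. 4.8 / Kani, row A4-62).
[cite: BirkenhakeWilhelm2003, §4 Prop. 4.7–4.8 (p. 1830)] [cite: HashimotoMurabayashi1995, Def. 3.6] -/
theorem humbertLocusOfInvariant_eq_iUnion_humbertLocusPrim (Δ : ℤ) :
    humbertLocusOfInvariant Δ = ⋃ (m : ℤ) (_ : 0 < m ∧ m ^ 2 ∣ Δ), humbertLocusPrim (Δ / m ^ 2) := by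
  ext Z
  simp only [mem_humbertLocusOfInvariant_iff, Set.mem_iUnion, mem_humbertLocusPrim_iff, exists_prop]
  constructor
  · rintro ⟨q, hq0, hqΔ, hZ⟩
    obtain ⟨m, q', hm, rfl, hprim⟩ := exists_eq_smul_primitive hq0
    have hm2 : (|m| ^ 2 : ℤ) ≠ 0 := pow_ne_zero 2 (abs_ne_zero.2 hm)
    refine ⟨|m|, ⟨abs_pos.2 hm, ?_⟩, q', hprim, ?_, ?_⟩
    · rw [← hqΔ, humbertInvariant_smul, sq_abs]
      exact dvd_mul_right _ _
    · rw [← hqΔ, humbertInvariant_smul, sq_abs, Int.mul_ediv_cancel_left _ (pow_ne_zero 2 hm)]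
    · rwa [intCast_smul_eq, humbertLocus_smul (Int.cast_ne_zero.2 hm)] at hZ
  · rintro ⟨m, ⟨hm, hdvd⟩, q', hprim, hΔ', hZ⟩
    refine ⟨m • q', smul_ne_zero hm.ne' hprim.ne_zero, ?_, ?_⟩
    · rw [humbertInvariant_smul, hΔ']
      exact Int.mul_ediv_cancel' hdvd
    · rw [intCast_smul_eq, humbertLocus_smul (Int.cast_ne_zero.2 hm.ne')]
      exact hZ

/-- **`N_Δ ⊆ H_Δ(𝔥₂) ⊆ ⋃ N_{Δ/m²}`, and for SQUARE-FREE `Δ` simply `H_Δ(𝔥₂) = N_Δ`.** [cite: BirkenhakeWilhelm2003, §4 Prop. 4.7 (p. 1830)] -/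
theorem humbertLocusOfInvariant_eq_humbertLocusPrim_of_squarefree {Δ : ℤ} (hΔ : Squarefree Δ) :
    humbertLocusOfInvariant Δ = humbertLocusPrim Δ := by
  refine Set.Subset.antisymm ?_ (humbertLocusPrim_subset_humbertLocusOfInvariant Δ)
  rw [humbertLocusOfInvariant_eq_iUnion_humbertLocusPrim]
  intro Z hZ
  simp only [Set.mem_iUnion, exists_prop] at hZ
  obtain ⟨m, ⟨hm, hdvd⟩, hZ⟩ := hZ
  have hu : IsUnit m := hΔ m (by rwa [← sq])
  rcases Int.isUnit_iff.1 hu with rfl | rfl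
  · simpa using hZ
  · omega

/-- **`N_Δ ≠ ∅ ⟺ Δ > 0 ∧ Δ ≡ 0, 1 mod 4`** (non-emptiness by Runge's model at `(i, i)`, emptiness by row A4-64 FILE 1
`humbertLocusOfInvariant_nonempty_iff`). [cite: BirkenhakeWilhelm2003, §4 Prop. 4.7 (p. 1830)] [cite: HashimotoMurabayashi1995, Prop. 2.7] -/
theorem humbertLocusPrim_nonempty_iff (Δ : ℤ) :
    (humbertLocusPrim Δ).Nonempty ↔ 0 < Δ ∧ (Δ % 4 = 0 ∨ Δ % 4 = 1) := by
  constructor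
  · intro h
    exact (humbertLocusOfInvariant_nonempty_iff Δ).1 (h.mono (humbertLocusPrim_subset_humbertLocusOfInvariant Δ))
  · rintro ⟨hpos, hmod⟩
    have hΔ : 0 < quadDisc (Δ / 4) (Δ % 4) := by rwa [quadDisc_ediv_emod hmod]
    have h := range_modularEmbedding_subset_humbertLocusPrim hΔ ⟨fun _ ↦ UpperHalfPlane.I, rfl⟩
    rw [quadDisc_ediv_emod hmod] at h
    exact ⟨_, h⟩

end NDelta

/-! ## §2 `N_Δ` is `Sp₄(ℤ)`-stable -/

section Stable

/-- `Z ∈ H_q ⟹ ᵗM · Z ∈ H_{q^M}` (row A4-59″ (7)). [cite: BirkenhakeWilhelm2003, §4 eq. (7) (p. 1827)] -/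
theorem smul_mem_humbertLocus_humbertVectorConj {M : Matrix (Fin 2 ⊕ Fin 2) (Fin 2 ⊕ Fin 2) ℤ}
    (hM : Mᵀ * typeForm (fun _ : Fin 2 ↦ 1) * M = typeForm fun _ : Fin 2 ↦ 1) (q : Fin 5 → ℤ)
    {Z : siegelUpperHalfSpace 2} (hZ : Z ∈ humbertLocus (fun i ↦ (q i : ℂ))) :
    (⟨toGD (fun _ : Fin 2 ↦ 1) M, toGD_mem principalType_pos hM⟩ : Matrix.symplecticGroup (Fin 2) ℝ) • Z ∈
      humbertLocus (fun i ↦ (humbertVectorConj M q i : ℂ)) := by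
  rw [mem_humbertLocus_humbertVectorConj_iff hM q, inv_smul_smul]
  exact hZ

/-- One direction of the stability, for `M ∈ Sp₄(ℤ)` given as a matrix. [cite: BirkenhakeWilhelm2003, §4 eq. (7) (p. 1827)] -/
private theorem smul_mem_humbertLocusPrim {M : Matrix (Fin 2 ⊕ Fin 2) (Fin 2 ⊕ Fin 2) ℤ}
    (hM : Mᵀ * typeForm (fun _ : Fin 2 ↦ 1) * M = typeForm fun _ : Fin 2 ↦ 1) {Δ : ℤ} {Z : siegelUpperHalfSpace 2}
    (hZ : Z ∈ humbertLocusPrim Δ) :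
    (⟨toGD (fun _ : Fin 2 ↦ 1) M, toGD_mem principalType_pos hM⟩ : Matrix.symplecticGroup (Fin 2) ℝ) • Z ∈
      humbertLocusPrim Δ := by
  obtain ⟨q, hq, hqΔ, hZq⟩ := mem_humbertLocusPrim_iff.1 hZ
  exact mem_humbertLocusPrim_iff.2 ⟨humbertVectorConj M q, hq.of_humbertEquiv ⟨M, hM, rfl⟩,
    (humbertInvariant_humbertVectorConj hM q).trans hqΔ, smul_mem_humbertLocus_humbertVectorConj hM q hZq⟩

/-- **`N_Δ` is stable under `Sp₄(ℤ)`** (acting through row A4-16's `gDHom`): a primitive relation is transported to a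
primitive relation of the same invariant (FILE 1 `IsPrimitiveRel.of_humbertEquiv`, row A4-59″
`humbertInvariant_humbertVectorConj`) — `H_Δ = N_Δ/Sp₄(ℤ) ⊂ 𝒜₂` is well defined. [cite: HashimotoMurabayashi1995, Def. 3.6] [cite: BirkenhakeWilhelm2003, §4 eq. (7) (p. 1827)] -/
theorem smul_mem_humbertLocusPrim_iff (M : symplecticLatticeGroup (fun _ : Fin 2 ↦ 1)) (Δ : ℤ)
    (Z : siegelUpperHalfSpace 2) :
    gDHom (fun _ : Fin 2 ↦ 1) principalType_pos M • Z ∈ humbertLocusPrim Δ ↔ Z ∈ humbertLocusPrim Δ := by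
  have key : ∀ (M : symplecticLatticeGroup (fun _ : Fin 2 ↦ 1)) (Z : siegelUpperHalfSpace 2),
      Z ∈ humbertLocusPrim Δ → gDHom (fun _ : Fin 2 ↦ 1) principalType_pos M • Z ∈ humbertLocusPrim Δ := by
    intro M Z hZ
    have hM' := mem_symplecticLatticeGroup_iff.1 (M⁻¹).2
    have hP : gDHom (fun _ : Fin 2 ↦ 1) principalType_pos M =
        ⟨toGD (fun _ : Fin 2 ↦ 1) _, toGD_mem principalType_pos hM'⟩ := Subtype.ext (coe_gDHom principalType_pos M)
    rw [hP]
    exact smul_mem_humbertLocusPrim hM' hZ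
  refine ⟨fun h ↦ ?_, key M Z⟩
  have h' := key M⁻¹ _ h
  rwa [map_inv, inv_smul_smul] at h'

end Stable

/-! ## §3 Every Humbert locus of invariant `Δ` is an `Sp₄(ℤ)`-translate of Runge's model; `N_Δ = Sp₄(ℤ) · π_Δ(ℍ × ℍ)` -/

section Orbit

variable {q : Fin 5 → ℤ}

/-- **Every Humbert surface `H_q ⊂ 𝔥₂` of a PRIMITIVE relation is an `Sp₄(ℤ)`-translate of the Humbert locus of a
normal form: `H_q = ᵗM · H_{(k,l,−1,0,0)}` for every `(k, l)` with `l² + 4k = Δ(q)`** (Humbert's lemma, FILE 1, read on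
`𝔥₂` through row A4-59″ (7)). [cite: Runge1999EndomorphismRingsAbelianSurfaces, §4 p. 290] [cite: BirkenhakeWilhelm2003, §4 Prop. 4.5 (p. 1828)] -/
theorem IsPrimitiveRel.exists_humbertLocus_eq_image_humbertNormalForm (hq : IsPrimitiveRel q) {k l : ℤ}
    (h : quadDisc k l = humbertInvariant q) :
    ∃ (M : Matrix (Fin 2 ⊕ Fin 2) (Fin 2 ⊕ Fin 2) ℤ)
      (hM : Mᵀ * typeForm (fun _ : Fin 2 ↦ 1) * M = typeForm (fun _ : Fin 2 ↦ 1)),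
      humbertLocus (fun i ↦ (q i : ℂ)) =
        (fun Z ↦ (⟨toGD (fun _ : Fin 2 ↦ 1) M, toGD_mem principalType_pos hM⟩ : Matrix.symplecticGroup (Fin 2) ℝ) • Z) ''
          humbertLocus (fun i ↦ (humbertNormalForm k l i : ℂ)) := by
  obtain ⟨M, hM, -, hloc⟩ := (hq.humbertEquiv_humbertNormalForm h).symm.exists_humbertLocus_eq_image
  exact ⟨M, hM, hloc⟩

/-- **… equivalently an `Sp₄(ℤ)`-translate of RUNGE'S STANDARD MODEL: `H_q = ᵗM · π_{k,l}(ℍ × ℍ)`** (row A4-64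
`range_modularEmbedding`) — every component of `H_Δ(𝔥₂)` carried by a primitive relation is a copy of the Hilbert modular
surface parameter space `ℍ × ℍ` of the order of discriminant `Δ`. [cite: Runge1999EndomorphismRingsAbelianSurfaces, §4 pp. 290–291] [cite: HashimotoMurabayashi1995, Prop. 2.7] -/
theorem IsPrimitiveRel.exists_humbertLocus_eq_image_range_modularEmbedding (hq : IsPrimitiveRel q) {k l : ℤ}
    (h : quadDisc k l = humbertInvariant q) (hΔ : 0 < quadDisc k l) :
    ∃ (M : Matrix (Fin 2 ⊕ Fin 2) (Fin 2 ⊕ Fin 2) ℤ)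
      (hM : Mᵀ * typeForm (fun _ : Fin 2 ↦ 1) * M = typeForm (fun _ : Fin 2 ↦ 1)),
      humbertLocus (fun i ↦ (q i : ℂ)) =
        (fun Z ↦ (⟨toGD (fun _ : Fin 2 ↦ 1) M, toGD_mem principalType_pos hM⟩ : Matrix.symplecticGroup (Fin 2) ℝ) • Z) ''
          Set.range (modularEmbedding k l hΔ) := by
  rw [range_modularEmbedding hΔ]
  exact hq.exists_humbertLocus_eq_image_humbertNormalForm h

/-- **Pointwise: a point with a primitive relation of invariant `l² + 4k > 0` is an `Sp₄(ℤ)`-translate of a point of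
Runge's model** — Hashimoto–Murabayashi Prop. 2.7 / B–W Prop. 4.5 in the form "`Z = ᵗM · π_{k,l}(τ)`".
[cite: HashimotoMurabayashi1995, Prop. 2.7] [cite: BirkenhakeWilhelm2003, §4 Prop. 4.5 (p. 1828)] -/
theorem IsPrimitiveRel.exists_eq_smul_modularEmbedding (hq : IsPrimitiveRel q) {k l : ℤ}
    (h : quadDisc k l = humbertInvariant q) (hΔ : 0 < quadDisc k l) {Z : siegelUpperHalfSpace 2}
    (hZ : Z ∈ humbertLocus (fun i ↦ (q i : ℂ))) :
    ∃ (M : Matrix (Fin 2 ⊕ Fin 2) (Fin 2 ⊕ Fin 2) ℤ)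
      (hM : Mᵀ * typeForm (fun _ : Fin 2 ↦ 1) * M = typeForm (fun _ : Fin 2 ↦ 1)) (τ : Fin 2 → ℍ),
      Z = (⟨toGD (fun _ : Fin 2 ↦ 1) M, toGD_mem principalType_pos hM⟩ : Matrix.symplecticGroup (Fin 2) ℝ) •
        modularEmbedding k l hΔ τ := by
  obtain ⟨M, hM, hloc⟩ := hq.exists_humbertLocus_eq_image_range_modularEmbedding h hΔ
  rw [hloc] at hZ
  obtain ⟨_, ⟨τ, rfl⟩, rfl⟩ := hZ
  exact ⟨M, hM, τ, rfl⟩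

/-- **Conversely (B–W Prop. 4.5 read forward): a point of `H_q`, `q` primitive, is moved INTO Runge's model by some
`M ∈ Sp₄(ℤ)`: `ᵗM · Z ∈ π_{k,l}(ℍ × ℍ) = H_{(k,l,−1,0,0)}`.** [cite: BirkenhakeWilhelm2003, §4 Prop. 4.5 (p. 1828)] [cite: HashimotoMurabayashi1995, Prop. 2.7] -/
theorem IsPrimitiveRel.exists_smul_mem_humbertLocus_humbertNormalForm (hq : IsPrimitiveRel q) {k l : ℤ}
    (h : quadDisc k l = humbertInvariant q) {Z : siegelUpperHalfSpace 2} (hZ : Z ∈ humbertLocus (fun i ↦ (q i : ℂ))) :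
    ∃ (M : Matrix (Fin 2 ⊕ Fin 2) (Fin 2 ⊕ Fin 2) ℤ)
      (hM : Mᵀ * typeForm (fun _ : Fin 2 ↦ 1) * M = typeForm (fun _ : Fin 2 ↦ 1)),
      (⟨toGD (fun _ : Fin 2 ↦ 1) M, toGD_mem principalType_pos hM⟩ : Matrix.symplecticGroup (Fin 2) ℝ) • Z ∈
        humbertLocus (fun i ↦ (humbertNormalForm k l i : ℂ)) := by
  obtain ⟨M, hM, hconj⟩ := hq.humbertEquiv_humbertNormalForm h
  refine ⟨M, hM, ?_⟩
  rw [← hconj]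
  exact smul_mem_humbertLocus_humbertVectorConj hM q hZ

/-- **Birkenhake–Wilhelm's Proposition 4.5 AS PRINTED, `Δ ≡ 0 mod 4`, for every primitive relation** (no square-freeness):
"There is an `M ∈ Sp₄(ℤ)` such that `M(Z) = (z₁′ z₂′; z₂′ z₃′)` satisfies `−¼Δ z₁′ + z₃′ = 0`".
[cite: BirkenhakeWilhelm2003, §4 Prop. 4.5 (p. 1828)] -/
theorem IsPrimitiveRel.exists_smul_bw_zero (hq : IsPrimitiveRel q) (h0 : humbertInvariant q % 4 = 0)
    {Z : siegelUpperHalfSpace 2} (hZ : Z ∈ humbertLocus (fun i ↦ (q i : ℂ))) :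
    ∃ (M : Matrix (Fin 2 ⊕ Fin 2) (Fin 2 ⊕ Fin 2) ℤ)
      (hM : Mᵀ * typeForm (fun _ : Fin 2 ↦ 1) * M = typeForm (fun _ : Fin 2 ↦ 1)),
      -((humbertInvariant q / 4 : ℤ) : ℂ) *
          (((⟨toGD (fun _ : Fin 2 ↦ 1) M, toGD_mem principalType_pos hM⟩ : Matrix.symplecticGroup (Fin 2) ℝ) • Z :
            siegelUpperHalfSpace 2) : Matrix (Fin 2) (Fin 2) ℂ) 0 0 +
        (((⟨toGD (fun _ : Fin 2 ↦ 1) M, toGD_mem principalType_pos hM⟩ : Matrix.symplecticGroup (Fin 2) ℝ) • Z :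
            siegelUpperHalfSpace 2) : Matrix (Fin 2) (Fin 2) ℂ) 1 1 = 0 := by
  obtain ⟨M, hM, hconj⟩ := hq.humbertEquiv_bw_zero h0
  refine ⟨M, hM, ?_⟩
  have hmem := smul_mem_humbertLocus_humbertVectorConj hM q hZ
  rw [hconj, mem_humbertLocus_iff, singularRelation_apply] at hmem
  simp only [Matrix.cons_val_zero, Matrix.cons_val_one, Matrix.cons_val] at hmem
  push_cast at hmem
  linear_combination hmem

/-- **Birkenhake–Wilhelm's Proposition 4.5 AS PRINTED, `Δ ≡ 1 mod 4`, for every primitive relation**: "`M(Z)` satisfies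
`¼(1 − Δ)z₁′ + z₂′ + z₃′ = 0`". [cite: BirkenhakeWilhelm2003, §4 Prop. 4.5 (p. 1828)] -/
theorem IsPrimitiveRel.exists_smul_bw_one (hq : IsPrimitiveRel q) (h1 : humbertInvariant q % 4 = 1)
    {Z : siegelUpperHalfSpace 2} (hZ : Z ∈ humbertLocus (fun i ↦ (q i : ℂ))) :
    ∃ (M : Matrix (Fin 2 ⊕ Fin 2) (Fin 2 ⊕ Fin 2) ℤ)
      (hM : Mᵀ * typeForm (fun _ : Fin 2 ↦ 1) * M = typeForm (fun _ : Fin 2 ↦ 1)),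
      (((1 - humbertInvariant q) / 4 : ℤ) : ℂ) *
          (((⟨toGD (fun _ : Fin 2 ↦ 1) M, toGD_mem principalType_pos hM⟩ : Matrix.symplecticGroup (Fin 2) ℝ) • Z :
            siegelUpperHalfSpace 2) : Matrix (Fin 2) (Fin 2) ℂ) 0 0 +
        (((⟨toGD (fun _ : Fin 2 ↦ 1) M, toGD_mem principalType_pos hM⟩ : Matrix.symplecticGroup (Fin 2) ℝ) • Z :
            siegelUpperHalfSpace 2) : Matrix (Fin 2) (Fin 2) ℂ) 0 1 +
        (((⟨toGD (fun _ : Fin 2 ↦ 1) M, toGD_mem principalType_pos hM⟩ : Matrix.symplecticGroup (Fin 2) ℝ) • Z :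
            siegelUpperHalfSpace 2) : Matrix (Fin 2) (Fin 2) ℂ) 1 1 = 0 := by
  obtain ⟨M, hM, hconj⟩ := hq.humbertEquiv_bw_one h1
  refine ⟨M, hM, ?_⟩
  have hmem := smul_mem_humbertLocus_humbertVectorConj hM q hZ
  rw [hconj, mem_humbertLocus_iff, singularRelation_apply] at hmem
  simp only [Matrix.cons_val_zero, Matrix.cons_val_one, Matrix.cons_val] at hmem
  push_cast at hmem
  linear_combination hmem

/-- The `GL₄(ℤ)`-unit of an integral symplectic matrix (inverse `spInv M`, FILE 1). [cite: Lange2023AbelianVarietiesComplex, §8.2 (8.5)] -/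
def spUnit (M : Matrix (Fin 2 ⊕ Fin 2) (Fin 2 ⊕ Fin 2) ℤ)
    (hM : Mᵀ * typeForm (fun _ : Fin 2 ↦ 1) * M = typeForm (fun _ : Fin 2 ↦ 1)) :
    symplecticLatticeGroup (fun _ : Fin 2 ↦ 1) :=
  ⟨⟨M, spInv M, mul_spInv hM, spInv_mul hM⟩, mem_symplecticLatticeGroup_iff.2 hM⟩

/-- `gDHom (spUnit M) = (ᵗM)⁻¹` in `Sp₄(ℝ)` (row A4-16 `gDHom_inv`). [cite: Lange2023AbelianVarietiesComplex, §3.1.4 (3.8)] -/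
theorem gDHom_spUnit {M : Matrix (Fin 2 ⊕ Fin 2) (Fin 2 ⊕ Fin 2) ℤ}
    (hM : Mᵀ * typeForm (fun _ : Fin 2 ↦ 1) * M = typeForm (fun _ : Fin 2 ↦ 1)) :
    gDHom (fun _ : Fin 2 ↦ 1) principalType_pos (spUnit M hM) =
      (⟨toGD (fun _ : Fin 2 ↦ 1) M, toGD_mem principalType_pos hM⟩ : Matrix.symplecticGroup (Fin 2) ℝ)⁻¹ := by
  rw [← inv_inv (gDHom _ _ _), gDHom_inv]
  rfl

/-- **`N_Δ = Sp₄(ℤ) · π_{k,l}(ℍ × ℍ)` for `l² + 4k = Δ > 0`: Hashimoto–Murabayashi's `N_Δ` is EXACTLY the `Sp₄(ℤ)`-saturation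
of Runge's standard model** — so the Humbert surface `H_Δ = N_Δ/Sp₄(ℤ) ⊂ 𝒜₂` is the image of ONE copy of `ℍ × ℍ` (of the
Hilbert modular surface of the order `O_Δ`), "uniquely determined by `Δ`" (B–W), "each point of `H_Δ` can be represented
by `τ` satisfying `aτ₁ + bτ₂ + τ₃ = 0` with `b² − 4a = Δ`, `b = 0` or `1`" (HM Prop. 2.7).
[cite: HashimotoMurabayashi1995, Prop. 2.7 (= Prop. 3.7 of the RIMS Kôkyûroku 843 version, p. 191)] [cite: Runge1999EndomorphismRingsAbelianSurfaces, §4 pp. 290–291] [cite: BirkenhakeWilhelm2003, §4 Prop. 4.5 and the sentence after its proof (pp. 1828–1829)] -/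
theorem humbertLocusPrim_eq_iUnion_image_range_modularEmbedding {k l : ℤ} (hΔ : 0 < quadDisc k l) :
    humbertLocusPrim (quadDisc k l) =
      ⋃ M : symplecticLatticeGroup (fun _ : Fin 2 ↦ 1),
        (fun Z ↦ gDHom (fun _ : Fin 2 ↦ 1) principalType_pos M • Z) '' Set.range (modularEmbedding k l hΔ) := by
  apply Set.Subset.antisymm
  · intro Z hZ
    obtain ⟨q, hq, hqΔ, hZq⟩ := mem_humbertLocusPrim_iff.1 hZ
    obtain ⟨M, hM, hmem⟩ := hq.exists_smul_mem_humbertLocus_humbertNormalForm hqΔ.symm hZq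
    rw [← range_modularEmbedding hΔ] at hmem
    refine Set.mem_iUnion.2 ⟨spUnit M hM, _, hmem, ?_⟩
    change gDHom (fun _ : Fin 2 ↦ 1) principalType_pos (spUnit M hM) • _ • Z = Z
    rw [gDHom_spUnit hM, inv_smul_smul]
  · intro Z hZ
    obtain ⟨M, W, hW, rfl⟩ := Set.mem_iUnion.1 hZ
    exact (smul_mem_humbertLocusPrim_iff M _ W).2 (range_modularEmbedding_subset_humbertLocusPrim hΔ hW)

/-- **Pointwise form: `Z ∈ N_Δ ⟺ Z = γ · π_{k,l}(τ)` for some `γ ∈ Sp₄(ℤ)` and `τ ∈ ℍ × ℍ`.**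
[cite: HashimotoMurabayashi1995, Prop. 2.7] [cite: Runge1999EndomorphismRingsAbelianSurfaces, §4 p. 291] -/
theorem mem_humbertLocusPrim_iff_exists_smul_modularEmbedding {k l : ℤ} (hΔ : 0 < quadDisc k l)
    (Z : siegelUpperHalfSpace 2) :
    Z ∈ humbertLocusPrim (quadDisc k l) ↔
      ∃ (M : symplecticLatticeGroup (fun _ : Fin 2 ↦ 1)) (τ : Fin 2 → ℍ),
        Z = gDHom (fun _ : Fin 2 ↦ 1) principalType_pos M • modularEmbedding k l hΔ τ := by
  rw [humbertLocusPrim_eq_iUnion_image_range_modularEmbedding hΔ, Set.mem_iUnion]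
  constructor
  · rintro ⟨M, _, ⟨τ, rfl⟩, rfl⟩
    exact ⟨M, τ, rfl⟩
  · rintro ⟨M, τ, rfl⟩
    exact ⟨M, _, ⟨τ, rfl⟩, rfl⟩

/-- **`H_Δ(𝔥₂)` (all relations) `= ⋃_{m² Δ′ = Δ} Sp₄(ℤ) · π_{Δ′}(ℍ × ℍ)`**: a point of the full Humbert locus of
invariant `Δ` is `γ · π_{k,l}(τ)` with `γ ∈ Sp₄(ℤ)`, `τ ∈ ℍ × ℍ` and `m²(l² + 4k) = Δ` for some `m > 0` (content `m` of its relation).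
[cite: BirkenhakeWilhelm2003, §4 Prop. 4.7–4.8 (p. 1830)] [cite: Runge1999EndomorphismRingsAbelianSurfaces, §4 pp. 290–291] -/
theorem mem_humbertLocusOfInvariant_iff_exists_smul_modularEmbedding {Δ : ℤ} (Z : siegelUpperHalfSpace 2) :
    Z ∈ humbertLocusOfInvariant Δ ↔
      ∃ (m k l : ℤ) (hΔ : 0 < quadDisc k l) (M : symplecticLatticeGroup (fun _ : Fin 2 ↦ 1)) (τ : Fin 2 → ℍ),
        0 < m ∧ m ^ 2 * quadDisc k l = Δ ∧
          Z = gDHom (fun _ : Fin 2 ↦ 1) principalType_pos M • modularEmbedding k l hΔ τ := by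
  rw [humbertLocusOfInvariant_eq_iUnion_humbertLocusPrim]
  simp only [Set.mem_iUnion, exists_prop]
  constructor
  · rintro ⟨m, ⟨hm, hdvd⟩, hZ⟩
    obtain ⟨hpos, hmod⟩ := (humbertLocusPrim_nonempty_iff _).1 ⟨Z, hZ⟩
    have hΔ' : 0 < quadDisc (Δ / m ^ 2 / 4) (Δ / m ^ 2 % 4) := by rwa [quadDisc_ediv_emod hmod]
    rw [← quadDisc_ediv_emod hmod] at hZ
    obtain ⟨M, τ, rfl⟩ := (mem_humbertLocusPrim_iff_exists_smul_modularEmbedding hΔ' _).1 hZ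
    refine ⟨m, _, _, hΔ', M, τ, hm, ?_, rfl⟩
    rw [quadDisc_ediv_emod hmod]
    exact Int.mul_ediv_cancel' hdvd
  · rintro ⟨m, k, l, hΔ', M, τ, hm, hmΔ, rfl⟩
    refine ⟨m, ⟨hm, ⟨_, hmΔ.symm⟩⟩, ?_⟩
    rw [← hmΔ, Int.mul_ediv_cancel_left _ (pow_ne_zero 2 hm.ne')]
    exact (mem_humbertLocusPrim_iff_exists_smul_modularEmbedding hΔ' _).2 ⟨M, τ, rfl⟩

end Orbit

/-! ## §4 Invariant `1`: `N_1 = H_1(𝔥₂) = Sp₄(ℤ) · {diagonal period matrices}`; square invariants (Kani) -/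

section One

/-- **`H_1(𝔥₂) = N_1`** (`1` is square-free). [cite: BirkenhakeWilhelm2003, §4 Prop. 4.8 (p. 1830)] -/
theorem humbertLocusOfInvariant_one_eq_humbertLocusPrim : humbertLocusOfInvariant 1 = humbertLocusPrim 1 :=
  humbertLocusOfInvariant_eq_humbertLocusPrim_of_squarefree squarefree_one

/-- **THE HUMBERT SURFACE OF INVARIANT 1 IS THE `Sp₄(ℤ)`-ORBIT OF THE DIAGONAL: `H_1(𝔥₂) = ⋃_{γ ∈ Sp₄(ℤ)} γ · {Z ∈ 𝔥₂ : z₂ = 0}`**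
— a principally polarized abelian surface has a singular relation of invariant `1` (equivalently contains an elliptic
curve of degree `1`, row A4-62; equivalently splits as a polarized product `E₁ × E₂`, row A4-63) iff its period matrix is
`Sp₄(ℤ)`-equivalent to a DIAGONAL one (row A4-64 FILE 6: `π_{0,1}(τ) = P · diag(τ₁, τ₂)`, `range_diagPoint`).
[cite: BirkenhakeWilhelm2003, §4 Prop. 4.5 and Prop. 4.8 (pp. 1828–1830)] [cite: HashimotoMurabayashi1995, Prop. 2.7] -/
theorem humbertLocusOfInvariant_one_eq_iUnion_image_diagonal :
    humbertLocusOfInvariant 1 =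
      ⋃ M : symplecticLatticeGroup (fun _ : Fin 2 ↦ 1),
        (fun Z ↦ gDHom (fun _ : Fin 2 ↦ 1) principalType_pos M • Z) ''
          {Z : siegelUpperHalfSpace 2 | (Z : Matrix (Fin 2) (Fin 2) ℂ) 0 1 = 0} := by
  rw [humbertLocusOfInvariant_one_eq_humbertLocusPrim, ← quadDisc_zero_one,
    humbertLocusPrim_eq_iUnion_image_range_modularEmbedding quadDisc_zero_one_pos, ← range_diagPoint]
  have hrange : Set.range (modularEmbedding 0 1 quadDisc_zero_one_pos) = (fun Z ↦ splitSp • Z) '' Set.range diagPoint := by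
    rw [← Set.range_comp]
    congr 1
    funext τ
    exact modularEmbedding_zero_one_eq_smul_diagPoint τ
  rw [hrange]
  -- `splitSp = (gDHom u)` for the unit `u` of FILE 6's split matrix, up to inversion; reindex the union by `M ↦ M u⁻¹`
  set u : symplecticLatticeGroup (fun _ : Fin 2 ↦ 1) :=
    spUnit (blockDiag !![(1 : ℤ), 1; 1, 0] !![(0 : ℤ), 1; 1, -1]) (transpose_blockDiag_mul_typeForm_mul (by
      ext i j; fin_cases i <;> fin_cases j <;> simp [Matrix.mul_apply, Fin.sum_univ_two])) with hu
  have hsplit : (splitSp : Matrix.symplecticGroup (Fin 2) ℝ) = (gDHom (fun _ : Fin 2 ↦ 1) principalType_pos u)⁻¹ := by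
    rw [hu, gDHom_spUnit, inv_inv]
    rfl
  apply Set.Subset.antisymm
  · intro Z hZ
    obtain ⟨M, _, ⟨W, hW, rfl⟩, rfl⟩ := Set.mem_iUnion.1 hZ
    refine Set.mem_iUnion.2 ⟨M * u⁻¹, W, hW, ?_⟩
    change gDHom _ _ (M * u⁻¹) • W = gDHom _ _ M • splitSp • W
    rw [map_mul, map_inv, hsplit, mul_smul]
  · intro Z hZ
    obtain ⟨M, W, hW, rfl⟩ := Set.mem_iUnion.1 hZ
    refine Set.mem_iUnion.2 ⟨M * u, _, ⟨W, hW, rfl⟩, ?_⟩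
    change gDHom _ _ (M * u) • splitSp • W = gDHom _ _ M • W
    rw [map_mul, hsplit, mul_smul, smul_inv_smul]

/-- **Pointwise: `Z ∈ H_1(𝔥₂)` iff some `γ ∈ Sp₄(ℤ)` DIAGONALISES `Z`: `(γ · Z)₁₂ = 0`.** [cite: BirkenhakeWilhelm2003, §4 Prop. 4.5 and Prop. 4.8 (pp. 1828–1830)] -/
theorem mem_humbertLocusOfInvariant_one_iff_exists_smul_diagonal (Z : siegelUpperHalfSpace 2) :
    Z ∈ humbertLocusOfInvariant 1 ↔
      ∃ M : symplecticLatticeGroup (fun _ : Fin 2 ↦ 1),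
        ((gDHom (fun _ : Fin 2 ↦ 1) principalType_pos M • Z : siegelUpperHalfSpace 2) : Matrix (Fin 2) (Fin 2) ℂ) 0 1 = 0 := by
  rw [humbertLocusOfInvariant_one_eq_iUnion_image_diagonal, Set.mem_iUnion]
  constructor
  · rintro ⟨M, W, hW, rfl⟩
    refine ⟨M⁻¹, ?_⟩
    rwa [map_inv, inv_smul_smul]
  · rintro ⟨M, hM⟩
    refine ⟨M⁻¹, _, hM, ?_⟩
    change gDHom (fun _ : Fin 2 ↦ 1) principalType_pos M⁻¹ • gDHom (fun _ : Fin 2 ↦ 1) principalType_pos M • Z = Z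
    rw [map_inv, inv_smul_smul]

/-- **`N_{δ²}` is Kani's locus: `Z ∈ N_{δ²}` iff `X_Z` contains an elliptic curve of degree exactly `δ`** (row A4-62 FILE
`SiegelFamilyHumbertPrimitiveDegree`, by name). [cite: Kani1994EllipticCurvesAbelianSurfaces] [cite: BirkenhakeWilhelm2003, §4 Prop. 4.8 (p. 1830)] -/
theorem mem_humbertLocusPrim_sq_iff_exists_ellipticCurve {δ : ℤ} (hδ : 0 < δ) (Z : siegelUpperHalfSpace 2) :
    Z ∈ humbertLocusPrim (δ ^ 2) ↔
      ∃ Y : SubtorusFrame (prinPeriod Z) 2,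
        (δ : ℝ) = -prinForm Z ![latticeVec (prinPeriod Z) (Y.frame 0), latticeVec (prinPeriod Z) (Y.frame 1)] := by
  rw [mem_humbertLocusPrim_iff]
  exact exists_primitive_relation_sq_iff_exists_ellipticCurve_degree_eq Z hδ

/-- `quadDisc 0 δ = δ²` (the order `ℤ[ω]`, `ω² = δω`, of `ℚ × ℚ`). [cite: Runge1999EndomorphismRingsAbelianSurfaces, §4 p. 290] -/
theorem quadDisc_zero (δ : ℤ) : quadDisc 0 δ = δ ^ 2 := by
  rw [quadDisc]; ring

/-- `quadDisc 0 δ > 0` for `δ ≠ 0`. [cite: Runge1999EndomorphismRingsAbelianSurfaces, §4 p. 290] -/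
theorem quadDisc_zero_pos {δ : ℤ} (hδ : δ ≠ 0) : 0 < quadDisc 0 δ := by
  rw [quadDisc_zero]; positivity

/-- **… so the surfaces containing an elliptic curve of degree `δ` form ONE `Sp₄(ℤ)`-orbit of Runge's model of
discriminant `δ²`: `Z = γ · π_{(0,δ)}(τ)`** (`quadDisc 0 δ = δ²`; the order `ℤ[ω]`, `ω² = δω`, of `ℚ × ℚ`).
[cite: Kani1994EllipticCurvesAbelianSurfaces] [cite: Runge1999EndomorphismRingsAbelianSurfaces, §4 p. 290 ("`F` … is isomorphic to `ℚ × ℚ`")] -/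
theorem exists_ellipticCurve_iff_exists_smul_modularEmbedding {δ : ℤ} (hδ : 0 < δ) (Z : siegelUpperHalfSpace 2) :
    (∃ Y : SubtorusFrame (prinPeriod Z) 2,
        (δ : ℝ) = -prinForm Z ![latticeVec (prinPeriod Z) (Y.frame 0), latticeVec (prinPeriod Z) (Y.frame 1)]) ↔
      ∃ (M : symplecticLatticeGroup (fun _ : Fin 2 ↦ 1)) (τ : Fin 2 → ℍ),
        Z = gDHom (fun _ : Fin 2 ↦ 1) principalType_pos M • modularEmbedding 0 δ (quadDisc_zero_pos hδ.ne') τ := by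
  have key := mem_humbertLocusPrim_iff_exists_smul_modularEmbedding (quadDisc_zero_pos hδ.ne') Z
  rw [quadDisc_zero, mem_humbertLocusPrim_sq_iff_exists_ellipticCurve hδ] at key
  exact key

end One

/-! ## §5 Kani's `H_N = {⟨A,θ⟩ : q_{(A,θ)} → N}`: `N_Δ` through PRIMITIVE Néron–Severi classes -/

section NeronSeveri

variable (Z : siegelUpperHalfSpace 2)

/-- **`N_Δ` ON THE NÉRON–SEVERI SIDE (Kani's `H_N = {⟨A,θ⟩ : q_{(A,θ)} → N}`, primitive representation):
`Z ∈ N_Δ` iff the refined Humbert form `q̃_{θ_Z}(D) = (D·θ_Z)² − 2(D·D)` of the principally polarised surface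
`(X_Z, θ_Z)` takes the value `Δ` at some class `D ∈ NS(X_Z)` that is PRIMITIVE in `NS(X_Z)/ℤθ_Z`** (row A4-62:
`refinedHumbert … D = Δ(q(D))`, and `q(D)` is a primitive relation iff `D` is primitive modulo `θ_Z` —
`primitive_mod_of_humbertVector_primitive` / `humbertVector_primitive_of_primitive_mod`, BY NAME). With Humbert's lemma
(§3): these `Z` form ONE `Sp₄(ℤ)`-orbit of Runge's model. [cite: Kani2016ModuliJacobiansProductElliptic, (`H_N = {⟨A,θ⟩ : q_{(A,θ)} → N}`, quoted in arXiv:2602.14319 §6 (6.1))] [cite: Kani1994EllipticCurvesAbelianSurfaces] [cite: HashimotoMurabayashi1995, Def. 3.6] -/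
theorem mem_humbertLocusPrim_iff_exists_isNSForm_primitive {Δ : ℤ} :
    Z ∈ humbertLocusPrim Δ ↔
      ∃ η : (Fin 2 → ℂ) [⋀^Fin 2]→L[ℝ] ℝ, IsNSForm (prinPeriod Z) η ∧
        (∀ (k s : ℤ) (η' : (Fin 2 → ℂ) [⋀^Fin 2]→L[ℝ] ℝ), IsNSForm (prinPeriod Z) η' →
          η = k • η' + s • prinForm Z → k = 1 ∨ k = -1) ∧
        refinedHumbert (prinPeriod Z) stdIdx (prinForm Z) η = Δ := by
  constructor
  · intro hZ
    obtain ⟨q, hq, hqΔ, hZq⟩ := mem_humbertLocusPrim_iff.1 hZ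
    have hH : humbertClass Z q ∈ hodgeClasses (prinPeriod Z) 1 :=
      humbertClass_mem_hodgeClasses (mem_humbertLocus_iff.1 hZq)
    have hIH : humbertClass Z q ∈ integralHodgeClasses (prinPeriod Z) 1 :=
      (mem_integralHodgeClasses_iff (prinPeriod Z)).2
        ⟨humbertClass_mem_integralForms Z q, ((mem_hodgeClasses_iff (prinPeriod Z)).1 hH).2⟩
    obtain ⟨η, hηNS, hηγ⟩ := (mem_integralHodgeClasses_one_iff_exists (prinPeriod Z)).1 hIH
    have hηq : humbertVector (latticeForm Z (ofRealForm η)) = fun i ↦ (q i : ℂ) := by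
      rw [hηγ, humbertVector_humbertClass]
    refine ⟨η, (mem_neronSeveriGroup_iff (prinPeriod Z)).1 hηNS,
      primitive_mod_of_humbertVector_primitive Z hηq hq, ?_⟩
    rw [← hqΔ]
    exact refinedHumbert_prinForm_eq_of_humbertVector_eq Z hηq
  · rintro ⟨η, hη, hind, hqη⟩
    have hγI := ofRealForm_mem_integralForms_two (prinPeriod Z) hη
    have hγH := ofRealForm_mem_hodgeClasses_one (prinPeriod Z) hη
    obtain ⟨q, hq⟩ := exists_int_humbertVector_of_mem_integralForms hγI
    have hqΔ : humbertInvariant q = Δ := by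
      have h := refinedHumbert_prinForm_eq_of_humbertVector_eq Z hq
      rw [hqη] at h
      exact_mod_cast h.symm
    refine mem_humbertLocusPrim_iff.2 ⟨q, humbertVector_primitive_of_primitive_mod Z hη hq hind, hqΔ,
      mem_humbertLocus_iff.2 ?_⟩
    rw [← hq]
    exact (mem_hodgeClasses_iff_singularRelation_eq_zero Z (mem_rationalForms_of_mem_integralForms _ hγI)).1 hγH

/-- **Hence Kani's locus is one orbit of Runge's model: a principally polarised `X_Z` carries a Néron–Severi class
primitive modulo `θ_Z` with refined Humbert value `l² + 4k > 0` iff `Z = γ · π_{k,l}(τ)` for some `γ ∈ Sp₄(ℤ)`,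
`τ ∈ ℍ × ℍ`.** [cite: Kani2016ModuliJacobiansProductElliptic] [cite: Runge1999EndomorphismRingsAbelianSurfaces, §4 pp. 290–291] [cite: HashimotoMurabayashi1995, Prop. 2.7] -/
theorem exists_isNSForm_primitive_iff_exists_smul_modularEmbedding {k l : ℤ} (hΔ : 0 < quadDisc k l) :
    (∃ η : (Fin 2 → ℂ) [⋀^Fin 2]→L[ℝ] ℝ, IsNSForm (prinPeriod Z) η ∧
        (∀ (k' s : ℤ) (η' : (Fin 2 → ℂ) [⋀^Fin 2]→L[ℝ] ℝ), IsNSForm (prinPeriod Z) η' →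
          η = k' • η' + s • prinForm Z → k' = 1 ∨ k' = -1) ∧
        refinedHumbert (prinPeriod Z) stdIdx (prinForm Z) η = quadDisc k l) ↔
      ∃ (M : symplecticLatticeGroup (fun _ : Fin 2 ↦ 1)) (τ : Fin 2 → ℍ),
        Z = gDHom (fun _ : Fin 2 ↦ 1) principalType_pos M • modularEmbedding k l hΔ τ := by
  rw [← mem_humbertLocusPrim_iff_exists_smul_modularEmbedding hΔ Z, mem_humbertLocusPrim_iff_exists_isNSForm_primitive Z]

end NeronSeveri

end SiegelModuli

end Literature.AlgebraicGeometry.ModuliOfAbelianVarieties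

end
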